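import Literature.MathematicalPhysics.QuantumFieldTheory.DimockYuan2024.FirstLinearEquation
import Literature.Analysis.OperatorTheory.CayleyUnitary
import Literature.Barriers.CriticalPhenomena.WeaklySAWFlowMap
import Mathlib

/-!
# Dimock–Yuan: the second linear equation of the flow (Lemmas 20, 21, 22) — the Jacobian of the
explicit flow certified, the `VV` block bound (pingpong) with explicit constants, and Lemma 22's
Neumann-series mechanism PROVED model-free

**Citation header (reproduction of PUBLISHED work; template file of the Balaban lattice Yang–Mills
cell `pub-balaban`, TEMPLATE.md §16.2; no manuscript under audit is touched).**
J. Dimock, C. Yuan, *Structural stability of the RG flow in the Gross–Neveu model*,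
Ann. Henri Poincaré **25** (2024), doi 10.1007/s00023-024-01427-0 (= arXiv:2303.07916v3)
[DimockYuan2024GNFlow], section *"The flow"* = **§4 of arXiv v3** (TeX l. 3274, `\label{five}` being a NAME;
printed p. 55 ff.; the lineage's earlier leaves `QuadraticFlow`/`QuadraticFlowSums`/`FirstLinearEquation` and
TEMPLATE.md ≤ v8.31 wrote «§5.x» for these subsections — corrected here after XREAD C-pv02g21-1 (D3); should
the AHP pagination differ, read «AHP § = arXiv v3 §4.x»): §4.2 *"Reduction of the problem"* (p. 57; (beaver)
TeX ll. 3424–3432, the weighted sequence spaces `X_w`, `X_r` ll. 3514–3526, p. 59), §4.3 ((amos1)/(amos2),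
ll. 3577–3596, p. 60), §4.4 *"The second linear equation"* (l. 3727, p. 62: the domain `x̄ + ⅛𝓑_{C_E}` and
(two), ll. 3728–3743; **Lemma 20** \label{twenty} ll. 3749–3765, p. 63; (new) l. 3785, (tiny) l. 3831; **Lemma 21**
\label{w} ll. 3815–3826, p. 64, with its proof ((wonder) l. 3855, «every entry» l. 3869, (pingpong) l. 3871,
(pingpong2) l. 3882, (dd) l. 3899, (yellow) l. 3933; ll. 3829–3948, pp. 64–66); **Lemma 22** \label{pixie2}
ll. 3951–3963, p. 66, with its proof — (verynew) l. 3970, the Neumann series, the `2 × 2` blocks; ll. 3968–4020,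
pp. 66–67) and §4.5 *"Proof of theorem 4"* (l. 4033), last paragraph (the vacuum energy, ll. 4079–4088, p. 68).  TeX line numbers refer to the cell's held source
`inputs/files/dimock/src/2303.07916/2303.07916.tex`; page numbers are those of the arXiv-v3 PDF (text layer,
`inputs/files/dimock/2303.07916.pdf`).

**What the source prints.**  For `x ∈ x̄ + ⅛𝓑_{C_E}` — (two): `‖E_k − Ē_k‖ ≤ ⅛C_Eḡ_k³`,
`|g_k − ḡ_k|, |z_k − z̄_k| ≤ ⅛C_Eḡ_k²|log ḡ_k|`, `|p_k − p̄_k|, |v_k − v̄_k| ≤ ⅛C_Eḡ_k²`, whence *"the bound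
on `g_k` implies say `⅘ḡ_k ≤ g_k ≤ (5/4)ḡ_k`"* — Lemma 20: *"`‖E_k‖_{h,Γ₄} ≤ ½C_E g_k³`, `|z_k| ≤ ½C_Z g_k`,
`|p_k|, |v_k| ≤ ½C_E g_k²`"*.  The second linear equation (new) `y_{k+1} = L_k y_k + 𝒲_k(t,x_k)y_k + r_k`,
`𝒲_k(t,x_k) = D_xΦ^t_k(x_k) − D_xΦ̄⁰_k(x̄_k)`, blocks `𝒲 = [[𝒲_EE, 𝒲_EV],[𝒲_VE, 𝒲_VV]]`; Lemma 21:
*"`‖𝒲_EE‖_{𝓛(X_w,X_r)} ≤ 𝒪(1)(L⁻² + L²h^{−½})`, `‖𝒲_VE‖ ≤ 𝒪(1)h⁻²`, `‖𝒲_EV‖ ≤ CC_Eh⁸g_f|log g_f|`,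
`‖𝒲_VV‖ ≤ CC_Eg_f|log g_f|²`"*, the last via (wonder) (the `4 × 4` matrix
`D_xΦ̄⁰_k(x_k) − D_xΦ̄⁰_k(x̄_k)`), *"every entry is bounded by `CC_Eḡ_k²|log ḡ_k|`"* and (pingpong)
`‖𝒲_VV f‖_{X_r} ≤ sup_k ḡ_{k+1}⁻³[CC_Eḡ_k²|log ḡ_k|]ḡ_k²|log ḡ_k|‖f‖_{X_w} ≤ sup_k CC_Eḡ_k|log ḡ_k|²‖f‖_{X_w}
≤ CC_Eg_f|log g_f|²‖f‖_{X_w}`.  Lemma 22: *"Let `g_f` be sufficiently small and suppose `x ∈ x̄ + ⅛𝓑_{C_E}`.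
Then for `r ∈ X_r` there exists a unique solution of (lumbar) `y_{k+1} = D_xΦ_k(t,x_k)y_k + r_k` in `X_w` with
null boundary conditions (bc0).  There is a constant `C` such that the linear solution operator
`y = S(t,x)r` satisfies `‖S(t,x)‖_{𝓛(X^r,X^w)} ≤ C`"*; proof: (lumbar) ⇔ (verynew) `y = S⁰𝒲(t,x)y + S⁰r`,
*"`y = (1 − S⁰𝒲(t,x))⁻¹S⁰r ≡ S(t,x)r` provided the inverse exists in `𝓛(X_w)`.  We argue below that
`‖S⁰𝒲‖_{𝓛(X_w)} < ½` so the inverse does exist with `‖(I − S⁰𝒲)⁻¹‖_{𝓛(X_w)} < 2`"*, and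
`S⁰𝒲 = diag(1, S⁰)·[[𝒲_EE, 𝒲_EV],[𝒲_VE, 𝒲_VV]]` with *"each entry … small"*.  Theorem 4, end:
`ε_{k+1} = L²(ε_k + ε*_k)`, `ε_k = L^{2k}ε_0 + Σ_{j<k}L^{2(k−j)}ε*_j`, `ε_0 = −Σ_{j<N}L^{−2j}ε*_j` ⇒ `ε_N = 0`.

**What is PROVED here** (Mathlib + the siblings `QuadraticFlow`/`QuadraticFlowSums`/`FirstLinearEquation`
+ the tree's `Literature.Analysis.OperatorTheory.CayleyUnitary` (Neumann-series norm bound, reused by name)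
+ two elementary monotonicity lemmas of `Literature.Barriers.CriticalPhenomena.WeaklySAWFlowMap`/
`…WeaklySAWQuadraticFlowCutoff` (reused by name);
everything along the sibling's backward quadratic flow `ḡ = gbar β N g_f`, `0 < C₋ ≤ β_k ≤ C₊`,
`0 ≤ β′_k ≤ β_k`, `|θ_k|, |θ^p_k|, |θ^v_k| ≤ C_θ`, the print's *"g_f sufficiently small"* made EXPLICIT at
each use):
* Part 0: the weight monotonicity along `ḡ` (`ḡ_k|log ḡ_k| ≤ g_f|log g_f|` for `g_f ≤ e⁻¹`,
  `ḡ_k(log ḡ_k)² ≤ g_f(log g_f)²` for `g_f ≤ e⁻²` — the two real-variable monotonicity facts are REUSED by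
  name from the tree's formalisation of [BBS15c], `CTWSAW.mul_abs_log_le_mul_abs_log` /
  `mul_log_sq_le_mul_log_sq`, whose weights (3.2) need exactly them) and **`g_near_gbar`**: (two) ⇒
  `⅘ḡ_k ≤ g_k ≤ (5/4)ḡ_k` under `C_E·g_f|log g_f| ≤ 8/5`, `g_f ≤ e⁻¹`.
* Part 4 (**Lemma 20**, scalar content): `lemma20_pv` (`|p_k| ≤ ½C_Eg_k²`), `lemma20_E` (in any normed
  group: `‖E_k‖ ≤ ¼C_Eḡ_k³ ≤ ½C_Eg_k³` from (entire)-with-`L,h`-large and (two)), `lemma20_z`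
  (`|z_k| ≤ (C_θ/C₋ + ⅕)ḡ_k ≤ ½C_Zg_k` with the EXPLICIT largeness `C_Z ≥ (5/2)(C_θ/C₋ + ⅕)` — Theorem 1's
  *"Let `L, h, C_Z, C_E` be sufficiently large and chosen in that order"*, l. 1313 — using the sibling's
  `QuadraticFlow.abs_zbar_le`).
* Part 1: the explicit flow (beaver) as `phibarG/Z/P/V` and **its Jacobian `jac` CERTIFIED entry by
  entry** — sixteen one-variable `HasDerivAt` theorems `hasDerivAt_phibar*_*` whose derivative values ARE
  the entries `jac i j`; `jac_at_bar` = (amos2) = the matrix `L_k` of the first linear equation, and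
  `jac_at_bar_mulVec` reproduces the four recursions the sibling `FirstLinearEquation` solves.
* Part 2: **(wonder)** `wonder := jac(x_k) − jac(x̄_k)` with all sixteen entries (`wonder_eq`) and its
  action on `f_k` (`wonder_mulVec`).
* Part 3: **`wonder_entries_le`** — *"every entry is bounded by `CC_Eḡ_k²|log ḡ_k|`"* with `C = C₊ + C_θ/2`
  (`g_f ≤ e⁻¹` gives `|log ḡ_k| ≥ 1`, which converts the `p, v`-inputs of (two) into the common currency) —,
  the weight arithmetic `weight_sq_le` (`(ḡ_k²|log ḡ_k|)² ≤ ḡ_{k+1}³·g_f(log g_f)²`, needs `g_f ≤ e⁻²`) and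
  `weight_EV_VE_EE` (the arithmetic of (dd)/(yellow)), and **`pingpong`**: for every `f_k` of `X_w`-size `F`,
  `|(𝒲_VV(k)f_k)_i| ≤ 3(C₊ + C_θ/2)·C_E·g_f(log g_f)²·ḡ_{k+1}³·F` — i.e. Lemma 21's fourth line
  `‖𝒲_VV‖_{𝓛(X_w,X_r)} ≤ CC_Eg_f|log g_f|²` with `C = 3C₊ + (3/2)C_θ`, under `g_f ≤ e⁻²`.
* Part 5 (**Lemma 22**, MODEL-FREE over abstract real normed spaces `X_w` (complete), `X_r`):
  `verynew_iff` ((lumbar) ⇔ (verynew) given the two-sided inverse `S⁰` of `D : y ↦ (y_{k+1} − L_ky_k)_k`),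
  `neumann_solve` (`‖T‖ ≤ q < 1` ⇒ `(1 − T)⁻¹b` is the unique solution of `y = Ty + b`,
  `‖(1 − T)⁻¹‖ ≤ (1 − q)⁻¹`), **`DimockYuan2024_lemma22_mechanism`** / `_half` / **`DimockYuan2024_lemma22`**
  (`S = (1 − S⁰𝒲)⁻¹S⁰`, existence, uniqueness, `‖S‖ ≤ (1 − q)⁻¹‖S⁰‖`, `= 2C` at `q = ½`), and the block
  assembly `opNorm_blocks_le` / **`norm_S0W_le`** (`‖diag(J,S⁰_V)·[[𝒲_EE,𝒲_EV],[𝒲_VE,𝒲_VV]]‖ ≤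
  max(‖𝒲_EE‖ + ‖𝒲_EV‖, ‖S⁰_V‖(‖𝒲_VE‖ + ‖𝒲_VV‖))` on sup-normed products, `‖J‖ ≤ 1` being the `E`-row of
  `S⁰`, ll. 3565–3571) / `norm_S0W_le_half`.
* Part 6: `vacuumEnergy_closed_form`, `vacuumEnergy_final_zero` (Theorem 4's last paragraph).

**NOT modelled / quoted only.**  D10's Banach spaces `𝒢_{h,Γ}` and everything measured in them: the
`E`-components, the maps `σ_k`, `ρ_k = (g*_k, z*_k, p*_k, v*_k)`, `E*_k` and Corollary 2's bounds on their
derivatives — hence Lemma 21's first three lines enter Part 5 only as the abstract blocks `𝒲_EE, 𝒲_EV, 𝒲_VE`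
with hypothesised norms (their WEIGHT arithmetic is `weight_EV_VE_EE`); the `t`-interpolation, the ODE
(hoo) in `X_w` and its Lipschitz/analyticity discussion (ll. 4033–4078) — i.e. Theorem 4 itself — are not
formalised in THIS file.  (v1.3 pointer: §4.2's (etc) ⇔ (approx1) and §4.5's reduction (boo) + (hoo) ⇒ (stunning)
with (BC), the ODE step confined to `x̄ + ⅛𝓑` — Mathlib's Picard–Lindelöf theorem for [AbMa78] — and the
`‖F‖ ≤ ‖S‖‖ρ‖` arithmetic are formalised MODEL-FREE in the sibling
`Literature.MathematicalPhysics.QuantumFieldTheory.DimockYuan2024.FlowReduction` (`DimockYuan2024_thm4_mechanism`),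
where the Lipschitz/continuity/bound properties of the actual `F = S(t,x)ρ(x)` — with `S(t,x)` and `‖S‖ ≤ 2C` from
this file's `DimockYuan2024_lemma22_mechanism` — and the identity (boo) enter as named hypotheses; what stays
un-formalised lineage-wide is exactly the content measured in D10's `𝒢_{h,Γ}` norms.)

**Located precisions (Dimock-internal, records only; D10 is template, not under audit; none affects a
conclusion).**  (i) (amos1)'s `(z, ∂/∂g)` entry prints `2θ_kg_k`; the derivative of (beaver)'s `z`-component
`z + θg² − θ^pgp − θ^vgv` is `2θ_kg_k − θ^p_kp_k − θ^v_kv_k` (`hasDerivAt_phibarZ_g`; at `x̄_k`, where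
`p̄ = v̄ = 0`, both give (amos2)).  (ii) Consequently (wonder)'s `z`-row: the derivative gives
`(2θ(g−ḡ) − θ^pp − θ^vv, 0, −θ^p(g−ḡ), −θ^v(g−ḡ))`, the print `(2θ(g−ḡ), 0, θ^p(g−ḡ), 2θ^v(g−ḡ))` (two
signs and a factor `2` besides (i)); every entry of either version is `≤ CC_Eḡ_k²|log ḡ_k|`, so (pingpong)
is unaffected.  (iii) (pingpong)'s last step `sup_k ḡ_k|log ḡ_k|² ≤ g_f|log g_f|²` uses that `x(log x)²`
increases on `(0, e⁻²]`, i.e. `g_f ≤ e⁻²` (inside *"g_f sufficiently small"*).  (iv) Lemma 20's `z`-line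
needs `C_Z ≥ (5/2)(C_θ/C₋ + ⅕)` relative to Lemma 17's constant (inside *"C_Z sufficiently large"*, l. 1313);
its proof line *"`|z_k| ≤ ½C_Zḡ_k`"* and the statement's `½C_Zg_k` differ by the factor `ḡ_k ≤ (5/4)g_k`,
absorbed the same way.  (v) With `X_w = X^E × X^V` sup-normed (as the definition of `‖·‖_{X_w}` by a
`sup` over components says), *"each entry is small"* with each block `< ½` gives `‖S⁰𝒲‖ < 1` — enough for
the inverse and for Lemma 22's `‖S‖ ≤ C` (`DimockYuan2024_lemma22_mechanism`, any `q < 1`) —, while the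
displayed `‖(I − S⁰𝒲)⁻¹‖ < 2` wants `≤ ¼` per block (`norm_S0W_le_half`), available from Lemma 21 by the
same choices of `L`, `h`, `g_f`.  (vi) Lemma 21's statement prints `‖𝒲_EE‖ ≤ 𝒪(1)(L⁻² + L²h^{−½})`
(l. 3819) while its proof concludes `𝒪(1)(L⁻¹ + L²h^{−½})` (l. 3946, from (bottle1)'s `𝒪(L⁻¹)`, l. 1361)
and Lemma 22's proof uses the `L⁻¹` form (l. 4011); either is `< ¼` for `L`, then `h`, large.  (vii) l. 3789
prints `𝒲_k(t,x_k) = D_xΦ^t_{k+1}(x_k) − D_xΦ̄⁰_k(x̄_k)` with `Φ^t_{k+1}` for `Φ^t_k` ((tiny) l. 3834 and (lumbar)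
l. 3955 have `k`; XREAD C-lit2g19-11 INFO I1).

**Prior art IN THE TREE (pointer; recorded by the cell's β sub-cell in `BETA/TRANSFER.md`).**  D10 §4
*"is similar to"* [BBS15c] = Bauerschmidt–Brydges–Slade, *Structural stability of a dynamical system near a
non-hyperbolic fixed point*, AHP **16** (2015) = arXiv:1211.2477, whose main Theorem 1.4(i) (existence AND
uniqueness of the flow of `Φ = (ψ, φ̄ + ρ)` on `X_j = 𝒲_j ⊕ ℝ³` with the mixed boundary conditions
`(K₀, g₀)` given, `(z_∞, μ_∞) = (0,0)`, under (A1)–(A3)) is PROVED in this tree over abstract Banach spaces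
`𝒲_j`: `Literature.Barriers.CriticalPhenomena.CTWSAW.BBS_thm14_exists_flow` / `perturbedFlow_unique`
(`WeaklySAWFlowTheorem.lean`, with the series `WeaklySAWFlow{StructuralStability, Linearised, WeightedSpaces,
SbarOperator, Perturbation, Map, Contraction}.lean`: quadratic flow, `L_j = DΦ̄⁰_j(x̊_j)` with
`hasFDerivAt_map`, `S̄ = diag(1, S̄_{𝒱𝒱})` as a bounded operator on `ℓ^∞`, and a CONTRACTION road that its
authors document as replacing the printed ODE/`S(t,x) = (1 − S̄W)⁻¹S̄` road of BBS §3.1 = D10 §4.4–4.5).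
ORIENTATION CAVEAT: both recursions run toward the infrared; BBS (infrared-free WSAW, coupling DECREASING
along the flow) prescribes the MARGINAL coupling INITIALLY (`ḡ₀ = g₀`, `ḡ_{j+1} = ḡ_j − β_jḡ_j²`), `K₀` initially
and `(z_∞, μ_∞)` finally; D10 (asymptotically free GN₂, coupling INCREASING along the flow) and B12 Theorem 2
prescribe the marginal coupling FINALLY (`g_N = g_f`, `ḡ_{k+1} = ḡ_k + β_kḡ_k²` solved backwards — the
siblings' `gbar`) and everything else initially (`E_0 = z_0 = p_0 = v_0 = 0`); in both the coupling is pinned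
where it is LARGEST.  So the tree's theorem is a twin of D10 Theorem 4 of the same stable-manifold type (the
«infrared twin» of v1.1's wording, in the sense just said), not a statement from which Theorem 4 follows.  The present leaf is complementary to that series: it certifies D10's own Jacobian and
`VV` block (Parts 1–3) and proves the printed Neumann-series road of Lemma 22 abstractly (Part 5), which the
series deliberately bypasses.

**Why it is in the tree / scope.**  TEMPLATE.md §16.2 grades D10's Lemmas 18–22 / Theorem 4 «N» for the
Bałaban audit (B12 Theorem 2 asks only for the existence of SOME coupling trajectory;
`Step.couplingTrajectory_exists`); with `QuadraticFlow`, `QuadraticFlowSums`, `FirstLinearEquation` and this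
leaf, the SCALAR content of D10's flow section — §4.1, the `(g,z,p,v)` block of Lemma 18, Lemma 20, the `VV`
block of Lemma 21 — and the functional-analytic SKELETON of Lemma 22 are kernel, each with explicit constants
and explicit smallness; what a written proof of B12 Theorem 2 «in this style» (§16.2 row «Reduction of the
problem») would still have to supply is exactly the NOT-modelled
list above (the single-step map and its derivative bounds in the model's own norms) plus Theorem 4's ODE
step.  SCOPE: Dimock–Yuan's RG is a momentum-slice decomposition on the continuum torus for Gross–Neveu₂,
not Bałaban's block averaging; nothing here refers to or asserts anything about Bałaban's papers.  Value =
kernel reproduction of printed lemmas of the template literature with explicit constants, NOT summit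
progress.

(v1.2, same unit/gen — DOCSTRING-ONLY fold of XREAD C-lit2g19-11 (beta-lit2-g19; verdict ok ∣ ABSOLUTE-RULE 0
∣ misquotations 0/14 ∣ kernel ✓ ∣ DOCFIX-LOW 1): D1 — a cluster of TeX LINE locators was low by ≈ 17–19
((wonder) 3855, «every entry» 3869, (pingpong) 3871–3880, (tiny) 3831, (dd) 3899, (yellow) 3933, vacuum
energy 4079–4088) and is re-set to the `\label` lines; INFO I1 recorded as precision (vii); the orientation
sentence sharpened as in TEMPLATE.md v8.32.1; declarations byte-identical to v1/v1.1.)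

Cell records: unit `b2b-balaban-template` gen 25; GAPS.md C-tmpl25-1.  NEW leaf; imports the sibling
`…DimockYuan2024.FirstLinearEquation`, `Literature.Analysis.OperatorTheory.CayleyUnitary`,
`Literature.Barriers.CriticalPhenomena.WeaklySAWFlowMap` (two elementary lemmas by name) and Mathlib;
sub-namespace `…DimockYuan2024.SecondLinearEquation`; modifies nothing.
-/

noncomputable section

open Finset Real Set

namespace Literature.MathematicalPhysics.QuantumFieldTheory.DimockYuan2024.SecondLinearEquation

open Literature.MathematicalPhysics.QuantumFieldTheory.DimockYuan2024.QuadraticFlowSums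
open Literature.MathematicalPhysics.QuantumFieldTheory.DimockYuan2024.FirstLinearEquation
-- the two monotonicity facts (`t|log t|` on `(0, e⁻¹]`, `t log²t` on `(0, e⁻²]`) are REUSED from the tree's
-- formalisation of [BBS15c] (Bauerschmidt–Brydges–Slade 2015), whose weights need exactly the same facts
open Literature.Barriers.CriticalPhenomena.CTWSAW (mul_abs_log_le_mul_abs_log mul_log_sq_le_mul_log_sq)

variable {β βp : ℕ → ℝ} {N : ℕ} {gf : ℝ}

/-! ## Part 0. The weight monotonicity along `ḡ`; the domain `x̄ + ⅛𝓑_{C_E}` (ll. 3730–3747) -/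

/-- Along the flow with `g_f ≤ e⁻¹`: `1 ≤ |log ḡ_k|`. [folklore] -/
theorem one_le_abs_log_gbar (hβ : ∀ k, 0 < β k) (hgf : 0 < gf) (hgfe : gf ≤ Real.exp (-1))
    (k : ℕ) : 1 ≤ |Real.log (gbar β N gf k)| := by
  have hx := gbar_pos hβ hgf (N := N) k
  have hxe : gbar β N gf k ≤ Real.exp (-1) := (gbar_le_final hβ hgf k).trans hgfe
  have hx1 : gbar β N gf k < 1 := lt_of_le_of_lt hxe (Real.exp_lt_one_iff.mpr (by norm_num))
  rw [abs_of_neg (Real.log_neg hx hx1)]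
  have : Real.log (gbar β N gf k) ≤ -1 := by
    rw [Real.log_le_iff_le_exp hx]; exact hxe
  linarith

/-- Along the flow with `g_f ≤ e⁻¹`: `ḡ_k|log ḡ_k| ≤ g_f|log g_f|`. [folklore] -/
theorem gbar_mul_abs_log_le (hβ : ∀ k, 0 < β k) (hgf : 0 < gf) (hgfe : gf ≤ Real.exp (-1))
    (k : ℕ) : gbar β N gf k * |Real.log (gbar β N gf k)| ≤ gf * |Real.log gf| :=
  mul_abs_log_le_mul_abs_log (gbar_pos hβ hgf k) (gbar_le_final hβ hgf k) hgfe

/-- Along the flow with `g_f ≤ e⁻²`: `ḡ_k(log ḡ_k)² ≤ g_f(log g_f)²` — the last step of (pingpong).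
[cite: DimockYuan2024GNFlow, proof of Lemma 21, (pingpong) last line (arXiv:2303.07916v3 TeX ll. 3878–3880, p. 65)] -/
theorem gbar_mul_log_sq_le (hβ : ∀ k, 0 < β k) (hgf : 0 < gf) (hgfe : gf ≤ Real.exp (-2))
    (k : ℕ) : gbar β N gf k * Real.log (gbar β N gf k) ^ 2 ≤ gf * Real.log gf ^ 2 :=
  mul_log_sq_le_mul_log_sq (gbar_pos hβ hgf k) (gbar_le_final hβ hgf k) hgfe

/-- **The domain `x̄ + ⅛𝓑_{C_E}` pins `g_k` to `ḡ_k`** (ll. 3740–3743): from (two)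
`|g_k − ḡ_k| ≤ ⅛C_E ḡ_k²|log ḡ_k|` and the EXPLICIT smallness `C_E·g_f|log g_f| ≤ 8/5`, `g_f ≤ e⁻¹`
(the print's *"Always assuming `ḡ_k ≤ g_f < ½g_max` are sufficiently small"*):
*"`⅘ḡ_k ≤ g_k ≤ (5/4)ḡ_k`"* (indeed `≤ (6/5)ḡ_k`).
[cite: DimockYuan2024GNFlow, §4.4 (two) and the display after it (arXiv:2303.07916v3 TeX ll. 3733–3743, pp. 62–63)] -/
theorem g_near_gbar {CE : ℝ} {g : ℕ → ℝ} (hβ : ∀ k, 0 < β k) (hgf : 0 < gf)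
    (hgfe : gf ≤ Real.exp (-1)) (hsmallE : CE * (gf * |Real.log gf|) ≤ 8 / 5) {k : ℕ}
    (htwo : |g k - gbar β N gf k| ≤ CE / 8 * (gbar β N gf k ^ 2 * |Real.log (gbar β N gf k)|)) :
    4 / 5 * gbar β N gf k ≤ g k ∧ g k ≤ 5 / 4 * gbar β N gf k := by
  have hx := gbar_pos hβ hgf (N := N) k
  have hm := gbar_mul_abs_log_le (N := N) hβ hgf hgfe k
  have hkey : CE / 8 * (gbar β N gf k ^ 2 * |Real.log (gbar β N gf k)|)
      ≤ 1 / 5 * gbar β N gf k := by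
    have : CE / 8 * (gbar β N gf k ^ 2 * |Real.log (gbar β N gf k)|)
        = gbar β N gf k * (CE * (gbar β N gf k * |Real.log (gbar β N gf k)|)) / 8 := by ring
    rw [this]
    have h2 : CE * (gbar β N gf k * |Real.log (gbar β N gf k)|) ≤ 8 / 5 := by
      rcases le_or_gt 0 CE with hCE | hCE
      · exact (mul_le_mul_of_nonneg_left hm hCE).trans hsmallE
      · have : CE * (gbar β N gf k * |Real.log (gbar β N gf k)|) ≤ 0 :=
          mul_nonpos_of_nonpos_of_nonneg hCE.le (by positivity)
        linarith
    have := mul_le_mul_of_nonneg_left h2 hx.le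
    linarith
  have h := (abs_le.mp (htwo.trans hkey))
  constructor <;> linarith [h.1, h.2]

/-! ## Part 4 (placed first: it needs Part 0 only). Lemma 20 (twenty), ll. 3749–3765 — scalar content -/

/-- **Lemma 20, `p`/`v` line**: `|p_k| ≤ ⅛C_E ḡ_k²` and `⅘ḡ_k ≤ g_k` give *"`|p_k| ≤ ½C_E g_k²`"*
(indeed `(25/128)C_E g_k²`). [cite: DimockYuan2024GNFlow, Lemma 20 (\label{twenty}) and its proof (arXiv:2303.07916v3 TeX ll. 3749–3765, p. 63)] -/
theorem lemma20_pv {CE gb g p : ℝ} (hCE : 0 ≤ CE) (hgb : 0 ≤ gb) (hg : 4 / 5 * gb ≤ g)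
    (hp : |p| ≤ CE / 8 * gb ^ 2) : |p| ≤ 1 / 2 * CE * g ^ 2 := by
  have h1 : gb ^ 2 ≤ (5 / 4) ^ 2 * g ^ 2 := by nlinarith
  nlinarith

/-- **Lemma 20, `E` line (scalar content)**: in any normed group, `‖Ē_k‖ ≤ ⅛C_E ḡ_k³` ((entire) with
`L, h` large, l. 3761) and `‖E_k − Ē_k‖ ≤ ⅛C_E ḡ_k³` ((two)) give `‖E_k‖ ≤ ¼C_E ḡ_k³ ≤ ½C_E g_k³`
(using `⅘ḡ_k ≤ g_k`; indeed `¼·(125/64) < ½`).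
[cite: DimockYuan2024GNFlow, Lemma 20 (\label{twenty}), proof ll. 3761–3763 (arXiv:2303.07916v3, p. 63)] -/
theorem lemma20_E {V : Type*} [SeminormedAddCommGroup V] {CE gb g : ℝ} {E Ebar : V}
    (hCE : 0 ≤ CE) (hgb : 0 ≤ gb) (hg : 4 / 5 * gb ≤ g)
    (hEbar : ‖Ebar‖ ≤ CE / 8 * gb ^ 3) (hdiff : ‖E - Ebar‖ ≤ CE / 8 * gb ^ 3) :
    ‖E‖ ≤ 1 / 4 * CE * gb ^ 3 ∧ ‖E‖ ≤ 1 / 2 * CE * g ^ 3 := by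
  have hE : ‖E‖ ≤ ‖E - Ebar‖ + ‖Ebar‖ := by
    calc ‖E‖ = ‖(E - Ebar) + Ebar‖ := by rw [sub_add_cancel]
      _ ≤ ‖E - Ebar‖ + ‖Ebar‖ := norm_add_le _ _
  have h1 : ‖E‖ ≤ 1 / 4 * CE * gb ^ 3 := by linarith
  refine ⟨h1, h1.trans ?_⟩
  have hg0 : 0 ≤ g := by linarith
  have h3 : gb ^ 3 ≤ (5 / 4) ^ 3 * g ^ 3 := by
    have : gb ≤ 5 / 4 * g := by linarith
    calc gb ^ 3 ≤ (5 / 4 * g) ^ 3 := by gcongr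
      _ = (5 / 4) ^ 3 * g ^ 3 := by ring
  have h4 := mul_le_mul_of_nonneg_left h3 hCE
  have h5 : 0 ≤ CE * g ^ 3 := mul_nonneg hCE (pow_nonneg hg0 3)
  linarith

/-- **Lemma 20, `z` line**: `|z̄_k| ≤ (C_θ/C₋)ḡ_k` (Lemma 17 (2), the sibling's `abs_zbar_le`) and
`|z_k − z̄_k| ≤ ⅛C_E ḡ_k²|log ḡ_k| ≤ ⅕ḡ_k` (smallness as in `g_near_gbar`) give
`|z_k| ≤ (C_θ/C₋ + ⅕)ḡ_k ≤ ½C_Z g_k` as soon as `C_Z ≥ (5/2)(C_θ/C₋ + ⅕)` — the EXPLICIT form of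
*"`C_Z` sufficiently large"* (Theorem 1, l. 1313: *"Let `L, h, C_Z, C_E` be sufficiently large and chosen in that order"*).
[cite: DimockYuan2024GNFlow, Lemma 20 (\label{twenty}), proof l. 3764 (arXiv:2303.07916v3, p. 63)] -/
theorem lemma20_z {Cm Cp Cθ CE CZ : ℝ} {θ : ℕ → ℝ} {g z : ℕ → ℝ} (hCm : 0 < Cm)
    (hβ : ∀ k, Cm ≤ β k ∧ β k ≤ Cp) (hθ : ∀ k, |θ k| ≤ Cθ) (hgf : 0 < gf)
    (hgfe : gf ≤ Real.exp (-1)) (hsmallE : CE * (gf * |Real.log gf|) ≤ 8 / 5)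
    (hCZ : 5 / 2 * (Cθ / Cm + 1 / 5) ≤ CZ) {k : ℕ} (hk : k ≤ N)
    (htwo_g : |g k - gbar β N gf k| ≤ CE / 8 * (gbar β N gf k ^ 2 * |Real.log (gbar β N gf k)|))
    (htwo_z : |z k - zbar θ β N gf k|
      ≤ CE / 8 * (gbar β N gf k ^ 2 * |Real.log (gbar β N gf k)|)) :
    |z k| ≤ (Cθ / Cm + 1 / 5) * gbar β N gf k ∧ |z k| ≤ 1 / 2 * CZ * g k := by
  have hβpos : ∀ k, 0 < β k := fun k => lt_of_lt_of_le hCm (hβ k).1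
  have hx := gbar_pos hβpos hgf (N := N) k
  have hzb := abs_zbar_le (θ := θ) (N := N) hCm (fun k => (hβ k).1) hθ hgf hk
  obtain ⟨hglo, -⟩ := g_near_gbar hβpos hgf hgfe hsmallE htwo_g
  -- `⅛C_E ḡ²|log ḡ| ≤ ⅕ ḡ` exactly as in `g_near_gbar`
  have hm := gbar_mul_abs_log_le (N := N) hβpos hgf hgfe k
  have hkey : CE / 8 * (gbar β N gf k ^ 2 * |Real.log (gbar β N gf k)|)
      ≤ 1 / 5 * gbar β N gf k := by
    have : CE / 8 * (gbar β N gf k ^ 2 * |Real.log (gbar β N gf k)|)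
        = gbar β N gf k * (CE * (gbar β N gf k * |Real.log (gbar β N gf k)|)) / 8 := by ring
    rw [this]
    have h2 : CE * (gbar β N gf k * |Real.log (gbar β N gf k)|) ≤ 8 / 5 := by
      rcases le_or_gt 0 CE with hCE | hCE
      · exact (mul_le_mul_of_nonneg_left hm hCE).trans hsmallE
      · have : CE * (gbar β N gf k * |Real.log (gbar β N gf k)|) ≤ 0 :=
          mul_nonpos_of_nonpos_of_nonneg hCE.le (by positivity)
        linarith
    have := mul_le_mul_of_nonneg_left h2 hx.le
    linarith
  have hz : |z k| ≤ |z k - zbar θ β N gf k| + |zbar θ β N gf k| := by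
    calc |z k| = |(z k - zbar θ β N gf k) + zbar θ β N gf k| := by rw [sub_add_cancel]
      _ ≤ _ := abs_add_le _ _
  have h1 : |z k| ≤ (Cθ / Cm + 1 / 5) * gbar β N gf k := by
    have := htwo_z.trans hkey
    nlinarith
  refine ⟨h1, h1.trans ?_⟩
  have hc : 0 ≤ Cθ / Cm + 1 / 5 := by
    have : 0 ≤ Cθ := le_trans (abs_nonneg _) (hθ 0)
    positivity
  calc (Cθ / Cm + 1 / 5) * gbar β N gf k ≤ (Cθ / Cm + 1 / 5) * (5 / 4 * g k) :=
        mul_le_mul_of_nonneg_left (by linarith) hc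
    _ = 1 / 2 * (5 / 2 * (Cθ / Cm + 1 / 5)) * g k := by ring
    _ ≤ 1 / 2 * CZ * g k := by
        have hg0 : 0 ≤ g k := by linarith
        nlinarith


/-! ## Part 1. The explicit flow (beaver) and its Jacobian (amos1)/(amos2), certified entry by entry -/

/-- (beaver), `g`-component: `g + β g² − 2β′ g p − 4β′ g v`.
[cite: DimockYuan2024GNFlow, §4.2 (beaver) (arXiv:2303.07916v3 TeX ll. 3424–3432, p. 57)] -/
def phibarG (b bp g p v : ℝ) : ℝ := g + b * g ^ 2 - 2 * bp * g * p - 4 * bp * g * v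

/-- (beaver), `z`-component: `z + θ g² − θ^p g p − θ^v g v`.
[cite: DimockYuan2024GNFlow, §4.2 (beaver) (arXiv:2303.07916v3 TeX ll. 3424–3432, p. 57)] -/
def phibarZ (th thp thv g z p v : ℝ) : ℝ := z + th * g ^ 2 - thp * g * p - thv * g * v

/-- (beaver), `p`-component: `p − 2β′ g v`.
[cite: DimockYuan2024GNFlow, §4.2 (beaver) (arXiv:2303.07916v3 TeX ll. 3424–3432, p. 57)] -/
def phibarP (bp g p v : ℝ) : ℝ := p - 2 * bp * g * v

/-- (beaver), `v`-component: `v − β′ g p`.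
[cite: DimockYuan2024GNFlow, §4.2 (beaver) (arXiv:2303.07916v3 TeX ll. 3424–3432, p. 57)] -/
def phibarV (bp g p v : ℝ) : ℝ := v - bp * g * p

/-- **The Jacobian `D_x Φ̄⁰_k(x_k)` of (beaver) in the variables `(g, z, p, v)`** (rows = the components
`g, z, p, v`; columns = `∂/∂g, ∂/∂z, ∂/∂p, ∂/∂v`).  Every entry is CERTIFIED below as the one-variable
derivative of the corresponding component (`hasDerivAt_phibar*_*`).  It agrees with the printed (amos1)
except in the entry `(z, ∂g)`, where (amos1) prints `2θ_k g_k` and the derivative of (beaver)'s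
`z`-component `z + θg² − θ^p g p − θ^v g v` is `2θ_k g_k − θ^p_k p_k − θ^v_k v_k` (located Dimock-internal
slip, harmless: at `x̄_k` (`p̄ = v̄ = 0`) both give (amos2), and in (wonder) the extra terms obey the same
entry bound — see `wonder_eq` and Part 3).
[cite: DimockYuan2024GNFlow, proof of Lemma 18, (amos1) (arXiv:2303.07916v3 TeX ll. 3577–3586, p. 60)] -/
def jac (b bp th thp thv g p v : ℝ) : Matrix (Fin 4) (Fin 4) ℝ :=
  !![1 + 2 * b * g - 2 * bp * p - 4 * bp * v, 0, -2 * bp * g, -4 * bp * g;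
     2 * th * g - thp * p - thv * v, 1, -thp * g, -thv * g;
     -2 * bp * v, 0, 1, -2 * bp * g;
     -bp * p, 0, -bp * g, 1]

/-- Derivative of a real quadratic `y ↦ a + c₁y + c₂y²` (helper). [folklore] -/
theorem hasDerivAt_quadratic (a c₁ c₂ x : ℝ) :
    HasDerivAt (fun y => a + c₁ * y + c₂ * (y * y)) (c₁ + 2 * c₂ * x) x := by
  have h : HasDerivAt (fun y => a + c₁ * y + c₂ * (y * y))
      (0 + c₁ * 1 + c₂ * (1 * x + x * 1)) x :=
    ((hasDerivAt_const x a).add ((hasDerivAt_id' x).const_mul c₁)).add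
      (((hasDerivAt_id' x).mul (hasDerivAt_id' x)).const_mul c₂)
  exact h.congr_deriv (by ring)

section Jacobian

variable (b bp th thp thv g z p v : ℝ)

/-- `∂φ̄_g/∂g = 1 + 2βg − 2β′p − 4β′v` = `jac 0 0`. [cite: DimockYuan2024GNFlow, (amos1) row 1 (arXiv:2303.07916v3 TeX l. 3578)] -/
theorem hasDerivAt_phibarG_g :
    HasDerivAt (fun y => phibarG b bp y p v) (jac b bp th thp thv g p v 0 0) g := by
  have h := hasDerivAt_quadratic 0 (1 - 2 * bp * p - 4 * bp * v) b g
  have hf : (fun y => phibarG b bp y p v) = fun y => 0 + (1 - 2 * bp * p - 4 * bp * v) * y + b * (y * y) := by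
    funext y; simp only [phibarG]; ring
  rw [hf]
  exact h.congr_deriv (by simp [jac]; ring)

/-- `∂φ̄_g/∂z = 0` = `jac 0 1`. [cite: DimockYuan2024GNFlow, (amos1) row 1] -/
theorem hasDerivAt_phibarG_z :
    HasDerivAt (fun _y : ℝ => phibarG b bp g p v) (jac b bp th thp thv g p v 0 1) z := by
  have h := hasDerivAt_const z (phibarG b bp g p v)
  exact h.congr_deriv (by simp [jac])

/-- `∂φ̄_g/∂p = −2β′g` = `jac 0 2`. [cite: DimockYuan2024GNFlow, (amos1) row 1] -/
theorem hasDerivAt_phibarG_p :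
    HasDerivAt (fun y => phibarG b bp g y v) (jac b bp th thp thv g p v 0 2) p := by
  have h := hasDerivAt_quadratic (g + b * g ^ 2 - 4 * bp * g * v) (-2 * bp * g) 0 p
  have hf : (fun y => phibarG b bp g y v)
      = fun y => (g + b * g ^ 2 - 4 * bp * g * v) + (-2 * bp * g) * y + 0 * (y * y) := by
    funext y; simp only [phibarG]; ring
  rw [hf]
  exact h.congr_deriv (by simp [jac])

/-- `∂φ̄_g/∂v = −4β′g` = `jac 0 3`. [cite: DimockYuan2024GNFlow, (amos1) row 1] -/
theorem hasDerivAt_phibarG_v :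
    HasDerivAt (fun y => phibarG b bp g p y) (jac b bp th thp thv g p v 0 3) v := by
  have h := hasDerivAt_quadratic (g + b * g ^ 2 - 2 * bp * g * p) (-4 * bp * g) 0 v
  have hf : (fun y => phibarG b bp g p y)
      = fun y => (g + b * g ^ 2 - 2 * bp * g * p) + (-4 * bp * g) * y + 0 * (y * y) := by
    funext y; simp only [phibarG]; ring
  rw [hf]
  exact h.congr_deriv (by simp [jac])

/-- `∂φ̄_z/∂g = 2θg − θ^p p − θ^v v` = `jac 1 0` ((amos1) prints `2θ_k g_k` here — see `jac`).
[cite: DimockYuan2024GNFlow, (beaver) and (amos1) row 2 (arXiv:2303.07916v3 TeX ll. 3427, 3579)] -/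
theorem hasDerivAt_phibarZ_g :
    HasDerivAt (fun y => phibarZ th thp thv y z p v) (jac b bp th thp thv g p v 1 0) g := by
  have h := hasDerivAt_quadratic z (-thp * p - thv * v) th g
  have hf : (fun y => phibarZ th thp thv y z p v)
      = fun y => z + (-thp * p - thv * v) * y + th * (y * y) := by
    funext y; simp only [phibarZ]; ring
  rw [hf]
  exact h.congr_deriv (by simp [jac]; ring)

/-- `∂φ̄_z/∂z = 1` = `jac 1 1`. [cite: DimockYuan2024GNFlow, (amos1) row 2] -/
theorem hasDerivAt_phibarZ_z :
    HasDerivAt (fun y => phibarZ th thp thv g y p v) (jac b bp th thp thv g p v 1 1) z := by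
  have h := hasDerivAt_quadratic (th * g ^ 2 - thp * g * p - thv * g * v) 1 0 z
  have hf : (fun y => phibarZ th thp thv g y p v)
      = fun y => (th * g ^ 2 - thp * g * p - thv * g * v) + 1 * y + 0 * (y * y) := by
    funext y; simp only [phibarZ]; ring
  rw [hf]
  exact h.congr_deriv (by simp [jac])

/-- `∂φ̄_z/∂p = −θ^p g` = `jac 1 2`. [cite: DimockYuan2024GNFlow, (amos1) row 2] -/
theorem hasDerivAt_phibarZ_p :
    HasDerivAt (fun y => phibarZ th thp thv g z y v) (jac b bp th thp thv g p v 1 2) p := by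
  have h := hasDerivAt_quadratic (z + th * g ^ 2 - thv * g * v) (-thp * g) 0 p
  have hf : (fun y => phibarZ th thp thv g z y v)
      = fun y => (z + th * g ^ 2 - thv * g * v) + (-thp * g) * y + 0 * (y * y) := by
    funext y; simp only [phibarZ]; ring
  rw [hf]
  exact h.congr_deriv (by simp [jac])

/-- `∂φ̄_z/∂v = −θ^v g` = `jac 1 3`. [cite: DimockYuan2024GNFlow, (amos1) row 2] -/
theorem hasDerivAt_phibarZ_v :
    HasDerivAt (fun y => phibarZ th thp thv g z p y) (jac b bp th thp thv g p v 1 3) v := by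
  have h := hasDerivAt_quadratic (z + th * g ^ 2 - thp * g * p) (-thv * g) 0 v
  have hf : (fun y => phibarZ th thp thv g z p y)
      = fun y => (z + th * g ^ 2 - thp * g * p) + (-thv * g) * y + 0 * (y * y) := by
    funext y; simp only [phibarZ]; ring
  rw [hf]
  exact h.congr_deriv (by simp [jac])

/-- `∂φ̄_p/∂g = −2β′v` = `jac 2 0`. [cite: DimockYuan2024GNFlow, (amos1) row 3] -/
theorem hasDerivAt_phibarP_g :
    HasDerivAt (fun y => phibarP bp y p v) (jac b bp th thp thv g p v 2 0) g := by
  have h := hasDerivAt_quadratic p (-2 * bp * v) 0 g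
  have hf : (fun y => phibarP bp y p v) = fun y => p + (-2 * bp * v) * y + 0 * (y * y) := by
    funext y; simp only [phibarP]; ring
  rw [hf]
  exact h.congr_deriv (by simp [jac])

/-- `∂φ̄_p/∂z = 0` = `jac 2 1`. [cite: DimockYuan2024GNFlow, (amos1) row 3] -/
theorem hasDerivAt_phibarP_z :
    HasDerivAt (fun _y : ℝ => phibarP bp g p v) (jac b bp th thp thv g p v 2 1) z := by
  have h := hasDerivAt_const z (phibarP bp g p v)
  exact h.congr_deriv (by simp [jac])

/-- `∂φ̄_p/∂p = 1` = `jac 2 2`. [cite: DimockYuan2024GNFlow, (amos1) row 3] -/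
theorem hasDerivAt_phibarP_p :
    HasDerivAt (fun y => phibarP bp g y v) (jac b bp th thp thv g p v 2 2) p := by
  have h := hasDerivAt_quadratic (-2 * bp * g * v) 1 0 p
  have hf : (fun y => phibarP bp g y v) = fun y => (-2 * bp * g * v) + 1 * y + 0 * (y * y) := by
    funext y; simp only [phibarP]; ring
  rw [hf]
  exact h.congr_deriv (by simp [jac])

/-- `∂φ̄_p/∂v = −2β′g` = `jac 2 3`. [cite: DimockYuan2024GNFlow, (amos1) row 3] -/
theorem hasDerivAt_phibarP_v :
    HasDerivAt (fun y => phibarP bp g p y) (jac b bp th thp thv g p v 2 3) v := by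
  have h := hasDerivAt_quadratic p (-2 * bp * g) 0 v
  have hf : (fun y => phibarP bp g p y) = fun y => p + (-2 * bp * g) * y + 0 * (y * y) := by
    funext y; simp only [phibarP]; ring
  rw [hf]
  exact h.congr_deriv (by simp [jac])

/-- `∂φ̄_v/∂g = −β′p` = `jac 3 0`. [cite: DimockYuan2024GNFlow, (amos1) row 4] -/
theorem hasDerivAt_phibarV_g :
    HasDerivAt (fun y => phibarV bp y p v) (jac b bp th thp thv g p v 3 0) g := by
  have h := hasDerivAt_quadratic v (-bp * p) 0 g
  have hf : (fun y => phibarV bp y p v) = fun y => v + (-bp * p) * y + 0 * (y * y) := by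
    funext y; simp only [phibarV]; ring
  rw [hf]
  exact h.congr_deriv (by simp [jac])

/-- `∂φ̄_v/∂z = 0` = `jac 3 1`. [cite: DimockYuan2024GNFlow, (amos1) row 4] -/
theorem hasDerivAt_phibarV_z :
    HasDerivAt (fun _y : ℝ => phibarV bp g p v) (jac b bp th thp thv g p v 3 1) z := by
  have h := hasDerivAt_const z (phibarV bp g p v)
  exact h.congr_deriv (by simp [jac])

/-- `∂φ̄_v/∂p = −β′g` = `jac 3 2`. [cite: DimockYuan2024GNFlow, (amos1) row 4] -/
theorem hasDerivAt_phibarV_p :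
    HasDerivAt (fun y => phibarV bp g y v) (jac b bp th thp thv g p v 3 2) p := by
  have h := hasDerivAt_quadratic v (-bp * g) 0 p
  have hf : (fun y => phibarV bp g y v) = fun y => v + (-bp * g) * y + 0 * (y * y) := by
    funext y; simp only [phibarV]; ring
  rw [hf]
  exact h.congr_deriv (by simp [jac])

/-- `∂φ̄_v/∂v = 1` = `jac 3 3`. [cite: DimockYuan2024GNFlow, (amos1) row 4] -/
theorem hasDerivAt_phibarV_v :
    HasDerivAt (fun y => phibarV bp g p y) (jac b bp th thp thv g p v 3 3) v := by
  have h := hasDerivAt_quadratic (-bp * g * p) 1 0 v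
  have hf : (fun y => phibarV bp g p y) = fun y => (-bp * g * p) + 1 * y + 0 * (y * y) := by
    funext y; simp only [phibarV]; ring
  rw [hf]
  exact h.congr_deriv (by simp [jac])

/-- **(amos2)**: at `x̄_k = (ḡ_k, z̄_k, 0, 0)` the Jacobian is the matrix `L_k` of the first linear
equation (the recursion of the sibling `FirstLinearEquation.DimockYuan2024_lemma18_scalar`).
[cite: DimockYuan2024GNFlow, proof of Lemma 18, (amos2) (arXiv:2303.07916v3 TeX ll. 3588–3596, p. 60)] -/
theorem jac_at_bar (gb : ℝ) :
    jac b bp th thp thv gb 0 0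
      = !![1 + 2 * b * gb, 0, -2 * bp * gb, -4 * bp * gb;
           2 * th * gb, 1, -thp * gb, -thv * gb;
           0, 0, 1, -2 * bp * gb;
           0, 0, -bp * gb, 1] := by
  ext i j
  fin_cases i <;> fin_cases j <;> simp [jac]

/-- `L_k` acting on `(g, z, p, v)` reproduces the four recursions of the first linear equation as used in
`FirstLinearEquation` (`g ↦ (1+2βḡ)g − 2β′ḡp − 4β′ḡv`, `z ↦ 2θḡg + z − θ^pḡp − θ^vḡv`,
`p ↦ p − 2β′ḡv`, `v ↦ −β′ḡp + v`). [cite: DimockYuan2024GNFlow, (amos2)] -/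
theorem jac_at_bar_mulVec (gb g' z' p' v' : ℝ) :
    Matrix.mulVec (jac b bp th thp thv gb 0 0) ![g', z', p', v']
      = ![(1 + 2 * b * gb) * g' - 2 * (bp * gb) * p' - 4 * (bp * gb) * v',
          z' + 2 * th * gb * g' - thp * gb * p' - thv * gb * v',
          p' - 2 * (bp * gb) * v',
          -(bp * gb) * p' + v'] := by
  funext i
  fin_cases i <;> simp [jac, Matrix.mulVec, dotProduct, Fin.sum_univ_four] <;> ring

end Jacobian

/-! ## Part 2. (wonder): `𝒲_VV = D_xΦ̄⁰_k(x_k) − D_xΦ̄⁰_k(x̄_k)` from the certified Jacobian -/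

/-- **`𝒲_VV(k)`** = `D_x Φ̄⁰_k(x_k) − D_x Φ̄⁰_k(x̄_k)` (the `VV` block of (tiny)'s `𝒲^{(II)}`; only it
contributes to `𝒲_VV`, l. 3853), COMPUTED from the certified Jacobian `jac`.
[cite: DimockYuan2024GNFlow, proof of Lemma 21, (wonder) first line (arXiv:2303.07916v3 TeX ll. 3855–3857, p. 64)] -/
def wonder (b bp th thp thv gb g p v : ℝ) : Matrix (Fin 4) (Fin 4) ℝ :=
  jac b bp th thp thv g p v - jac b bp th thp thv gb 0 0

/-- **(wonder), entry by entry.**  Rows `g, p, v` agree with the print letter for letter; in row `z` the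
derivative of (beaver) gives `(2θ(g−ḡ) − θ^p p − θ^v v, 0, −θ^p(g−ḡ), −θ^v(g−ḡ))` where the print has
`(2θ(g−ḡ), 0, θ^p(g−ḡ), 2θ^v(g−ḡ))` (located Dimock-internal slips, inherited from (amos1)'s `(z,∂g)` entry
plus two signs and a factor 2; harmless — *"every entry is bounded by `C C_E ḡ_k²|log ḡ_k|`"* holds for both,
Part 3).
[cite: DimockYuan2024GNFlow, proof of Lemma 21, (wonder) (arXiv:2303.07916v3 TeX ll. 3855–3866, p. 64)] -/
theorem wonder_eq (b bp th thp thv gb g p v : ℝ) :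
    wonder b bp th thp thv gb g p v
      = !![2 * b * (g - gb) - 2 * bp * p - 4 * bp * v, 0, -2 * bp * (g - gb), -4 * bp * (g - gb);
           2 * th * (g - gb) - thp * p - thv * v, 0, -thp * (g - gb), -thv * (g - gb);
           -2 * bp * v, 0, 0, -2 * bp * (g - gb);
           -bp * p, 0, -bp * (g - gb), 0] := by
  ext i j
  fin_cases i <;> fin_cases j <;> simp [wonder, jac] <;> ring

/-- `𝒲_VV(k)` acting on `f_k = (f^g, f^z, f^p, f^v)`, component by component. [cite: DimockYuan2024GNFlow, (wonder)] -/
theorem wonder_mulVec (b bp th thp thv gb g p v f0 f1 f2 f3 : ℝ) :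
    Matrix.mulVec (wonder b bp th thp thv gb g p v) ![f0, f1, f2, f3]
      = ![(2 * b * (g - gb) - 2 * bp * p - 4 * bp * v) * f0 + (-2 * bp * (g - gb)) * f2
            + (-4 * bp * (g - gb)) * f3,
          (2 * th * (g - gb) - thp * p - thv * v) * f0 + (-thp * (g - gb)) * f2
            + (-thv * (g - gb)) * f3,
          (-2 * bp * v) * f0 + 0 * f2 + (-2 * bp * (g - gb)) * f3,
          (-bp * p) * f0 + (-bp * (g - gb)) * f2 + 0 * f3] := by
  rw [wonder_eq]
  funext i
  fin_cases i <;> simp [Matrix.mulVec, dotProduct, Fin.sum_univ_four]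


/-! ## Part 3. (pingpong): every entry of `𝒲_VV` is `≤ C C_E ḡ_k²|log ḡ_k|`, hence
`‖𝒲_VV‖_{𝓛(X_w,X_r)} ≤ C C_E g_f|log g_f|²` — with explicit `C` and explicit smallness `g_f ≤ e⁻²` -/

/-- `|ax + by + cz| ≤ |a||x| + |b||y| + |c||z|` (helper). [folklore] -/
theorem abs_lin3_le (a x b y c z : ℝ) :
    |a * x + b * y + c * z| ≤ |a| * |x| + |b| * |y| + |c| * |z| := by
  calc |a * x + b * y + c * z| ≤ |a * x + b * y| + |c * z| := abs_add_le _ _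
    _ ≤ |a * x| + |b * y| + |c * z| := by linarith [abs_add_le (a * x) (b * y)]
    _ = |a| * |x| + |b| * |y| + |c| * |z| := by rw [abs_mul, abs_mul, abs_mul]

/-- The generic row step of (pingpong): three entries each `≤ A·w`, three inputs each `≤ w·F`
⇒ the row output is `≤ 3A·w²·F`. [folklore] -/
theorem row_core {a b c f0 f2 f3 A w F : ℝ} (hw : 0 ≤ w) (hF : 0 ≤ F)
    (ha : |a| ≤ A * w) (hb : |b| ≤ A * w) (hc : |c| ≤ A * w)
    (h0 : |f0| ≤ w * F) (h2 : |f2| ≤ w * F) (h3 : |f3| ≤ w * F) :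
    |a * f0 + b * f2 + c * f3| ≤ 3 * A * (w * w) * F := by
  have t := abs_lin3_le a f0 b f2 c f3
  have hwF : 0 ≤ w * F := mul_nonneg hw hF
  have t1 : |a| * |f0| ≤ (A * w) * (w * F) := mul_le_mul ha h0 (abs_nonneg _) ((abs_nonneg _).trans ha)
  have t2 : |b| * |f2| ≤ (A * w) * (w * F) := mul_le_mul hb h2 (abs_nonneg _) ((abs_nonneg _).trans hb)
  have t3 : |c| * |f3| ≤ (A * w) * (w * F) := mul_le_mul hc h3 (abs_nonneg _) ((abs_nonneg _).trans hc)
  calc |a * f0 + b * f2 + c * f3| ≤ |a| * |f0| + |b| * |f2| + |c| * |f3| := t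
    _ ≤ 3 * ((A * w) * (w * F)) := by linarith
    _ = 3 * A * (w * w) * F := by ring

/-- **The weight arithmetic of (pingpong)** (ll. 3871–3880): with `w_k = ḡ_k²|log ḡ_k|`,
`w_k² = ḡ_k⁴(log ḡ_k)² ≤ ḡ_{k+1}³·ḡ_k(log ḡ_k)² ≤ ḡ_{k+1}³·g_f(log g_f)²` (`ḡ_k ≤ ḡ_{k+1}`; the last step is
the monotonicity of `x(log x)²` on `(0, e⁻²]`, i.e. needs `g_f ≤ e⁻²`).
[cite: DimockYuan2024GNFlow, proof of Lemma 21, (pingpong) (arXiv:2303.07916v3 TeX ll. 3871–3880, pp. 64–65)] -/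
theorem weight_sq_le (hβ : ∀ k, 0 < β k) (hgf : 0 < gf) (hgfe : gf ≤ Real.exp (-2)) {k : ℕ}
    (hk : k < N) :
    (gbar β N gf k ^ 2 * |Real.log (gbar β N gf k)|) * (gbar β N gf k ^ 2 * |Real.log (gbar β N gf k)|)
      ≤ gbar β N gf (k + 1) ^ 3 * (gf * Real.log gf ^ 2) := by
  have hx := gbar_pos hβ hgf (N := N) k
  have hsucc := (gbar_lt_succ hβ hgf hk).le
  have hm := gbar_mul_log_sq_le (N := N) hβ hgf hgfe k
  have habs : |Real.log (gbar β N gf k)| * |Real.log (gbar β N gf k)| = Real.log (gbar β N gf k) ^ 2 := by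
    rw [abs_mul_abs_self, pow_two]
  have h3 : gbar β N gf k ^ 3 ≤ gbar β N gf (k + 1) ^ 3 := by gcongr
  calc (gbar β N gf k ^ 2 * |Real.log (gbar β N gf k)|) * (gbar β N gf k ^ 2 * |Real.log (gbar β N gf k)|)
      = gbar β N gf k ^ 3 * (gbar β N gf k * Real.log (gbar β N gf k) ^ 2) := by
        rw [← habs]; ring
    _ ≤ gbar β N gf (k + 1) ^ 3 * (gf * Real.log gf ^ 2) :=
        mul_le_mul h3 hm (mul_nonneg hx.le (sq_nonneg _))
          (pow_nonneg (gbar_pos hβ hgf (N := N) (k + 1)).le 3)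

/-- The weight arithmetic of (dd) (the `𝒲_EV` line, ll. 3899–3903) and of the `𝒲_VE`/`𝒲_EE` lines
(ll. 3907–3921; (yellow), ll. 3933–3935, and ll. 3936–3947): `ḡ_k²·ḡ_k²|log ḡ_k| ≤ ḡ_{k+1}³·g_f|log g_f|` (needs `g_f ≤ e⁻¹`) and
`ḡ_k³ ≤ ḡ_{k+1}³`.  (The functional-analytic inputs of those three lines — Corollary 2's bounds on
`∂E*_k/∂·`, Lemma `local`, (bottle1)/(bottle2) — live in the Banach spaces `𝒢_{h,Γ}` and are NOT modelled.)
[cite: DimockYuan2024GNFlow, proof of Lemma 21, (dd) and (yellow) (arXiv:2303.07916v3 TeX ll. 3899–3903, 3933–3935, p. 65)] -/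
theorem weight_EV_VE_EE (hβ : ∀ k, 0 < β k) (hgf : 0 < gf) (hgfe : gf ≤ Real.exp (-1)) {k : ℕ}
    (hk : k < N) :
    gbar β N gf k ^ 2 * (gbar β N gf k ^ 2 * |Real.log (gbar β N gf k)|)
        ≤ gbar β N gf (k + 1) ^ 3 * (gf * |Real.log gf|) ∧
      gbar β N gf k ^ 3 ≤ gbar β N gf (k + 1) ^ 3 := by
  have hx := gbar_pos hβ hgf (N := N) k
  have hsucc := (gbar_lt_succ hβ hgf hk).le
  have hm := gbar_mul_abs_log_le (N := N) hβ hgf hgfe k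
  have h3 : gbar β N gf k ^ 3 ≤ gbar β N gf (k + 1) ^ 3 := by gcongr
  refine ⟨?_, h3⟩
  calc gbar β N gf k ^ 2 * (gbar β N gf k ^ 2 * |Real.log (gbar β N gf k)|)
      = gbar β N gf k ^ 3 * (gbar β N gf k * |Real.log (gbar β N gf k)|) := by ring
    _ ≤ gbar β N gf (k + 1) ^ 3 * (gf * |Real.log gf|) :=
        mul_le_mul h3 hm (mul_nonneg hx.le (abs_nonneg _))
          (pow_nonneg (gbar_pos hβ hgf (N := N) (k + 1)).le 3)

section Pingpong

variable {Cm Cp Cθ CE F : ℝ} {θ θp θv : ℕ → ℝ} {g p v : ℕ → ℝ}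

/-- **"Every entry is bounded by `C C_E ḡ_k²|log ḡ_k|`"** (l. 3869) — here with `C = C₊ + C_θ/2`, for the
ten non-zero entries of (wonder) (as derived in `wonder_eq`), from (two) and `|β_k|, |β′_k| ≤ C₊`,
`|θ_k|, |θ^p_k|, |θ^v_k| ≤ C_θ`, `1 ≤ |log ḡ_k|` (`g_f ≤ e⁻¹`).  Listed in the order
`gg, gp, gv, zg, zp, zv, pg, pv, vg, vp`.
[cite: DimockYuan2024GNFlow, proof of Lemma 21, sentence after (wonder) (arXiv:2303.07916v3 TeX ll. 3868–3870, p. 64)] -/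
theorem wonder_entries_le (hCm : 0 < Cm) (hβ : ∀ k, Cm ≤ β k ∧ β k ≤ Cp)
    (hβp : ∀ k, 0 ≤ βp k ∧ βp k ≤ β k) (hθ : ∀ k, |θ k| ≤ Cθ) (hθp : ∀ k, |θp k| ≤ Cθ)
    (hθv : ∀ k, |θv k| ≤ Cθ) (hgf : 0 < gf) (hgfe : gf ≤ Real.exp (-1)) (hCE : 0 ≤ CE) {k : ℕ}
    (htwo_g : |g k - gbar β N gf k| ≤ CE / 8 * (gbar β N gf k ^ 2 * |Real.log (gbar β N gf k)|))
    (htwo_p : |p k| ≤ CE / 8 * gbar β N gf k ^ 2) (htwo_v : |v k| ≤ CE / 8 * gbar β N gf k ^ 2) :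
    |2 * β k * (g k - gbar β N gf k) - 2 * βp k * p k - 4 * βp k * v k|
        ≤ (Cp + Cθ / 2) * CE * (gbar β N gf k ^ 2 * |Real.log (gbar β N gf k)|) ∧
    |(-2) * βp k * (g k - gbar β N gf k)|
        ≤ (Cp + Cθ / 2) * CE * (gbar β N gf k ^ 2 * |Real.log (gbar β N gf k)|) ∧
    |(-4) * βp k * (g k - gbar β N gf k)|
        ≤ (Cp + Cθ / 2) * CE * (gbar β N gf k ^ 2 * |Real.log (gbar β N gf k)|) ∧
    |2 * θ k * (g k - gbar β N gf k) - θp k * p k - θv k * v k|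
        ≤ (Cp + Cθ / 2) * CE * (gbar β N gf k ^ 2 * |Real.log (gbar β N gf k)|) ∧
    |(-θp k) * (g k - gbar β N gf k)|
        ≤ (Cp + Cθ / 2) * CE * (gbar β N gf k ^ 2 * |Real.log (gbar β N gf k)|) ∧
    |(-θv k) * (g k - gbar β N gf k)|
        ≤ (Cp + Cθ / 2) * CE * (gbar β N gf k ^ 2 * |Real.log (gbar β N gf k)|) ∧
    |(-2) * βp k * v k| ≤ (Cp + Cθ / 2) * CE * (gbar β N gf k ^ 2 * |Real.log (gbar β N gf k)|) ∧
    |(-2) * βp k * (g k - gbar β N gf k)|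
        ≤ (Cp + Cθ / 2) * CE * (gbar β N gf k ^ 2 * |Real.log (gbar β N gf k)|) ∧
    |(-βp k) * p k| ≤ (Cp + Cθ / 2) * CE * (gbar β N gf k ^ 2 * |Real.log (gbar β N gf k)|) ∧
    |(-βp k) * (g k - gbar β N gf k)|
        ≤ (Cp + Cθ / 2) * CE * (gbar β N gf k ^ 2 * |Real.log (gbar β N gf k)|) := by
  have hβpos : ∀ k, 0 < β k := fun k => lt_of_lt_of_le hCm (hβ k).1
  have hx := gbar_pos hβpos hgf (N := N) k
  have hCp : 0 ≤ Cp := le_trans hCm.le ((hβ 0).1.trans (hβ 0).2)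
  have hCθ : 0 ≤ Cθ := le_trans (abs_nonneg _) (hθ 0)
  have hlog1 := one_le_abs_log_gbar (N := N) hβpos hgf hgfe k
  -- `|c| ≤ C`, `|x| ≤ X` ⇒ `|cx| ≤ CX`
  have abs_mul_le_mul_of_le : ∀ {c x C X : ℝ}, |c| ≤ C → |x| ≤ X → |c * x| ≤ C * X :=
    fun hc hx => by rw [abs_mul]; exact mul_le_mul hc hx (abs_nonneg _) ((abs_nonneg _).trans hc)
  set w := gbar β N gf k ^ 2 * |Real.log (gbar β N gf k)| with hw
  have hw0 : 0 ≤ w := by positivity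
  have hgb2 : gbar β N gf k ^ 2 ≤ w := by
    have := mul_le_mul_of_nonneg_left hlog1 (sq_nonneg (gbar β N gf k))
    simpa [w] using this
  -- the three (two)-inputs in the common currency `CE/8 · w`
  have hδ : |g k - gbar β N gf k| ≤ CE / 8 * w := htwo_g
  have hp' : |p k| ≤ CE / 8 * w := htwo_p.trans (by gcongr)
  have hv' : |v k| ≤ CE / 8 * w := htwo_v.trans (by gcongr)
  -- coefficient sizes
  have hb : |β k| ≤ Cp := by rw [abs_of_pos (hβpos k)]; exact (hβ k).2
  have hbp : |βp k| ≤ Cp := by rw [abs_of_nonneg (hβp k).1]; exact (hβp k).2.trans (hβ k).2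
  have h2b : |2 * β k| ≤ 2 * Cp := by rw [abs_mul, abs_two]; linarith
  have h2bp : |(-2) * βp k| ≤ 2 * Cp := by rw [abs_mul, abs_neg, abs_two]; linarith
  have h4bp : |(-4) * βp k| ≤ 4 * Cp := by
    rw [abs_mul, abs_neg, show |(4 : ℝ)| = 4 from abs_of_pos (by norm_num)]; linarith
  have h1bp : |(-βp k)| ≤ Cp := by rw [abs_neg]; exact hbp
  have h2θ : |2 * θ k| ≤ 2 * Cθ := by rw [abs_mul, abs_two]; linarith [hθ k]
  have h1θp : |(-θp k)| ≤ Cθ := by rw [abs_neg]; exact hθp k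
  have h1θv : |(-θv k)| ≤ Cθ := by rw [abs_neg]; exact hθv k
  -- `(C₊ + C_θ/2)·C_E·w` dominates every `c·C₊·C_E·w` (`c ≤ 1`) and every `c·C_θ·C_E·w` (`c ≤ ½`)
  have hAw : (Cp + Cθ / 2) * CE * w = Cp * (CE * w) + Cθ / 2 * (CE * w) := by ring
  have hCEw : 0 ≤ CE * w := mul_nonneg hCE hw0
  have hP : 0 ≤ Cp * (CE * w) := mul_nonneg hCp hCEw
  have hT : 0 ≤ Cθ * (CE * w) := mul_nonneg hCθ hCEw
  have hCEw8 : 0 ≤ CE / 8 * w := by positivity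
  refine ⟨?_, ?_, ?_, ?_, ?_, ?_, ?_, ?_, ?_, ?_⟩
  · -- gg
    have e : 2 * β k * (g k - gbar β N gf k) - 2 * βp k * p k - 4 * βp k * v k
        = (2 * β k) * (g k - gbar β N gf k) + ((-2) * βp k) * p k + ((-4) * βp k) * v k := by ring
    rw [e, hAw]
    have t := abs_lin3_le (2 * β k) (g k - gbar β N gf k) ((-2) * βp k) (p k) ((-4) * βp k) (v k)
    have t1 := abs_mul_le_mul_of_le h2b hδ
    have t2 := abs_mul_le_mul_of_le h2bp hp'
    have t3 := abs_mul_le_mul_of_le h4bp hv'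
    rw [abs_mul] at t1 t2 t3
    linarith
  · rw [hAw]; linarith [abs_mul_le_mul_of_le h2bp hδ]
  · rw [hAw]; linarith [abs_mul_le_mul_of_le h4bp hδ]
  · -- zg
    have e : 2 * θ k * (g k - gbar β N gf k) - θp k * p k - θv k * v k
        = (2 * θ k) * (g k - gbar β N gf k) + (-θp k) * p k + (-θv k) * v k := by ring
    rw [e, hAw]
    have t := abs_lin3_le (2 * θ k) (g k - gbar β N gf k) (-θp k) (p k) (-θv k) (v k)
    have t1 := abs_mul_le_mul_of_le h2θ hδ
    have t2 := abs_mul_le_mul_of_le h1θp hp'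
    have t3 := abs_mul_le_mul_of_le h1θv hv'
    rw [abs_mul] at t1 t2 t3
    linarith
  · rw [hAw]; linarith [abs_mul_le_mul_of_le h1θp hδ]
  · rw [hAw]; linarith [abs_mul_le_mul_of_le h1θv hδ]
  · rw [hAw]; linarith [abs_mul_le_mul_of_le h2bp hv']
  · rw [hAw]; linarith [abs_mul_le_mul_of_le h2bp hδ]
  · rw [hAw]; linarith [abs_mul_le_mul_of_le h1bp hp']
  · rw [hAw]; linarith [abs_mul_le_mul_of_le h1bp hδ]

/-- **(pingpong)/(pingpong2) — `‖𝒲_VV‖_{𝓛(X_w,X_r)} ≤ C C_E g_f|log g_f|²` in scalar form, EXPLICIT `C`.**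
Along the flow `ḡ` (`0 < C₋ ≤ β_k ≤ C₊`, `0 ≤ β′_k ≤ β_k`, `|θ_k|, |θ^p_k|, |θ^v_k| ≤ C_θ`) with `g_f ≤ e⁻²`
(the explicit form of *"g_f sufficiently small"* here), for `x_k` in the domain (two) and ANY
`f_k = (f^g, f^z, f^p, f^v)` of `X_w`-size `F` at `k` (`|f^g_k|, |f^z_k| ≤ ḡ_k²|log ḡ_k|F`, `|f^p_k|, |f^v_k| ≤ ḡ_k²F`),
every component of `(𝒲_VV f)_{k+1} = 𝒲_VV(k) f_k` has `X_r`-size at `k+1` at most `C·C_E·g_f(log g_f)²·F`: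
`|(𝒲_VV(k) f_k)_i| ≤ 3(C₊ + C_θ/2)·C_E·(g_f (log g_f)²)·ḡ_{k+1}³·F` (no hypothesis on `f^z` is needed: the
`z`-column of (wonder) vanishes).
[cite: DimockYuan2024GNFlow, Lemma 21 (\label{w}) fourth line and its proof (pingpong)–(pingpong2) (arXiv:2303.07916v3 TeX ll. 3815–3826, 3843–3884, pp. 64–65)] -/
theorem pingpong (hCm : 0 < Cm) (hβ : ∀ k, Cm ≤ β k ∧ β k ≤ Cp)
    (hβp : ∀ k, 0 ≤ βp k ∧ βp k ≤ β k) (hθ : ∀ k, |θ k| ≤ Cθ) (hθp : ∀ k, |θp k| ≤ Cθ)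
    (hθv : ∀ k, |θv k| ≤ Cθ) (hgf : 0 < gf) (hgfe : gf ≤ Real.exp (-2)) (hCE : 0 ≤ CE) (hF : 0 ≤ F)
    {k : ℕ} (hk : k < N)
    (htwo_g : |g k - gbar β N gf k| ≤ CE / 8 * (gbar β N gf k ^ 2 * |Real.log (gbar β N gf k)|))
    (htwo_p : |p k| ≤ CE / 8 * gbar β N gf k ^ 2) (htwo_v : |v k| ≤ CE / 8 * gbar β N gf k ^ 2)
    (f : Fin 4 → ℝ) (hf0 : |f 0| ≤ gbar β N gf k ^ 2 * |Real.log (gbar β N gf k)| * F)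
    (hf2 : |f 2| ≤ gbar β N gf k ^ 2 * F) (hf3 : |f 3| ≤ gbar β N gf k ^ 2 * F) (i : Fin 4) :
    |Matrix.mulVec (wonder (β k) (βp k) (θ k) (θp k) (θv k) (gbar β N gf k) (g k) (p k) (v k)) f i|
      ≤ 3 * (Cp + Cθ / 2) * CE * (gf * Real.log gf ^ 2) * gbar β N gf (k + 1) ^ 3 * F := by
  have hβpos : ∀ k, 0 < β k := fun k => lt_of_lt_of_le hCm (hβ k).1
  have hx := gbar_pos hβpos hgf (N := N) k
  have hgfe1 : gf ≤ Real.exp (-1) := hgfe.trans (Real.exp_le_exp.mpr (by norm_num))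
  have hlog1 := one_le_abs_log_gbar (N := N) hβpos hgf hgfe1 k
  set w := gbar β N gf k ^ 2 * |Real.log (gbar β N gf k)| with hw
  have hw0 : 0 ≤ w := by positivity
  have hgb2 : gbar β N gf k ^ 2 ≤ w := by
    have := mul_le_mul_of_nonneg_left hlog1 (sq_nonneg (gbar β N gf k))
    simpa [w] using this
  have hf2' : |f 2| ≤ w * F := hf2.trans (mul_le_mul_of_nonneg_right hgb2 hF)
  have hf3' : |f 3| ≤ w * F := hf3.trans (mul_le_mul_of_nonneg_right hgb2 hF)
  obtain ⟨egg, egp, egv, ezg, ezp, ezv, epg, epv, evg, evp⟩ :=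
    wonder_entries_le hCm hβ hβp hθ hθp hθv hgf hgfe1 hCE htwo_g htwo_p htwo_v (k := k)
  have hCp : 0 ≤ Cp := le_trans hCm.le ((hβ 0).1.trans (hβ 0).2)
  have hCθ : 0 ≤ Cθ := le_trans (abs_nonneg _) (hθ 0)
  have hA : 0 ≤ (Cp + Cθ / 2) * CE := by positivity
  have hzero : |(0 : ℝ)| ≤ (Cp + Cθ / 2) * CE * w := by rw [abs_zero]; positivity
  have hww := weight_sq_le (N := N) hβpos hgf hgfe hk
  -- the final weight step: 3A·w²·F ≤ 3A·ḡ_{k+1}³ g_f log²g_f · F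
  have hfinal : 3 * ((Cp + Cθ / 2) * CE) * (w * w) * F
      ≤ 3 * (Cp + Cθ / 2) * CE * (gf * Real.log gf ^ 2) * gbar β N gf (k + 1) ^ 3 * F := by
    have := mul_le_mul_of_nonneg_left hww (by positivity : 0 ≤ 3 * ((Cp + Cθ / 2) * CE) * F)
    nlinarith
  have hf : f = ![f 0, f 1, f 2, f 3] := by funext j; fin_cases j <;> rfl
  rw [hf, wonder_mulVec]
  fin_cases i
  · exact (row_core hw0 hF egg egp egv hf0 hf2' hf3').trans hfinal
  · exact (row_core hw0 hF ezg ezp ezv hf0 hf2' hf3').trans hfinal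
  · exact (row_core hw0 hF epg hzero epv hf0 hf2' hf3').trans hfinal
  · exact (row_core hw0 hF evg evp hzero hf0 hf2' hf3').trans hfinal

end Pingpong


/-! ## Part 5. Lemma 22 (pixie2): the second linear equation as a perturbation of the first — the
MECHANISM, model-free over abstract real normed spaces (ll. 3951–4020) -/

section Mechanism

variable {Xw Xr : Type*} [NormedAddCommGroup Xw] [NormedSpace ℝ Xw]
  [NormedAddCommGroup Xr] [NormedSpace ℝ Xr]

/-- **(lumbar) ⇔ (verynew)** (ll. 3968–3985).  Abstractly: let `D : X_w → X_r` be the linear map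
`y ↦ (y_{k+1} − L_k y_k)_k` on the space of sequences with the null boundary conditions (bc0), and let
`S⁰` be its two-sided inverse (Lemma 18: *"there exists a unique solution … `y = S⁰r`"*).  Then for any
linear `𝒲`: `D y = 𝒲y + r` (this is (new) = (lumbar)) iff `y = S⁰𝒲 y + S⁰ r` ((verynew)).
[cite: DimockYuan2024GNFlow, proof of Lemma 22, (verynew) and the display after it (arXiv:2303.07916v3 TeX ll. 3968–3985)] -/
theorem verynew_iff (D : Xw →L[ℝ] Xr) (S0 : Xr →L[ℝ] Xw) (hDS : ∀ r, D (S0 r) = r)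
    (hSD : ∀ y, S0 (D y) = y) (W : Xw →L[ℝ] Xr) (y : Xw) (r : Xr) :
    D y = W y + r ↔ y = S0 (W y) + S0 r := by
  constructor
  · intro h
    have h' := congrArg S0 h
    rw [hSD, map_add] at h'
    exact h'
  · intro h
    have h' := congrArg D h
    rw [map_add, hDS, hDS] at h'
    exact h'

variable [CompleteSpace Xw]

/-- **The Neumann step** (ll. 3986–3994: *"provided the inverse exists in `𝓛(X_w)` … `‖S⁰𝒲‖ < ½` so the
inverse does exist with `‖(I − S⁰𝒲)⁻¹‖ < 2`"*), for a general contraction bound: if `T : X_w →L X_w` has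
`‖T‖ ≤ q < 1` then `U = (1 − T)⁻¹` (`Ring.inverse`) satisfies `U b = T(U b) + b`, every solution of
`y = Ty + b` equals `U b`, and `‖U‖ ≤ (1 − q)⁻¹` (Neumann series; `‖1‖ ≤ 1` in `𝓛(X_w)`). [folklore] -/
theorem neumann_solve (T : Xw →L[ℝ] Xw) {q : ℝ} (hT : ‖T‖ ≤ q) (hq : q < 1) (b : Xw) :
    (Ring.inverse (1 - T) b = T (Ring.inverse (1 - T) b) + b) ∧
      (∀ y : Xw, y = T y + b → y = Ring.inverse (1 - T) b) ∧
      ‖(Ring.inverse (1 - T) : Xw →L[ℝ] Xw)‖ ≤ (1 - q)⁻¹ := by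
  set U : Xw →L[ℝ] Xw := Ring.inverse (1 - T)
  have hT1 : ‖T‖ < 1 := lt_of_le_of_lt hT hq
  have hu : IsUnit (1 - T) := isUnit_one_sub_of_norm_lt_one hT1
  have h1 : (1 - T) * U = 1 := Ring.mul_inverse_cancel _ hu
  have h2 : U * (1 - T) = 1 := Ring.inverse_mul_cancel _ hu
  refine ⟨?_, ?_, ?_⟩
  · have h : U b - T (U b) = b := congrArg (fun A : Xw →L[ℝ] Xw => A b) h1
    rw [sub_eq_iff_eq_add] at h
    rw [add_comm]; exact h
  · intro y hy
    have hy' : y - T y = b := sub_eq_of_eq_add' hy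
    have h : U (y - T y) = y := congrArg (fun A : Xw →L[ℝ] Xw => A y) h2
    rw [hy'] at h
    exact h.symm
  · have hn := Literature.Analysis.OperatorTheory.norm_ringInverse_one_sub_le hT1
    have h1le : ‖(1 : Xw →L[ℝ] Xw)‖ ≤ 1 := by
      rw [ContinuousLinearMap.one_def]; exact ContinuousLinearMap.norm_id_le
    have hinv : (1 - ‖T‖)⁻¹ ≤ (1 - q)⁻¹ := inv_anti₀ (by linarith) (by linarith)
    linarith

/-- **Dimock–Yuan 2024, Lemma 22 — the mechanism, PROVED model-free.**  Let `S⁰ : X_r →L X_w` (the solution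
operator of the first linear equation, Lemma 18: `‖S⁰‖_{𝓛(X_r,X_w)} ≤ C`) and `𝒲 : X_w →L X_r` (Lemma 21) satisfy
`‖S⁰𝒲‖_{𝓛(X_w)} ≤ q < 1` (print: `< ½`), `X_w` complete.  Then there is a bounded linear
`S = (1 − S⁰𝒲)⁻¹S⁰ : X_r →L X_w` such that for every `r`, `y = S r` solves (verynew) `y = S⁰𝒲y + S⁰r`, every
solution of (verynew) equals `S r` (uniqueness), and *"`‖S‖_{𝓛(X_r,X_w)} ≤ ‖S⁰‖_{𝓛(X_r,X_w)}‖(1 − S⁰𝒲)⁻¹‖_{𝓛(X_w)}`"*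
`≤ (1 − q)⁻¹‖S⁰‖` (`= 2C` at the print's `q = ½`).  With `verynew_iff` this is existence and uniqueness for
(lumbar) with the null boundary conditions.
[cite: DimockYuan2024GNFlow, Lemma 22 (\label{pixie2}) and its proof (arXiv:2303.07916v3 TeX ll. 3951–3994, p. 66)] -/
theorem DimockYuan2024_lemma22_mechanism (S0 : Xr →L[ℝ] Xw) (W : Xw →L[ℝ] Xr) {q : ℝ}
    (hq : ‖S0.comp W‖ ≤ q) (hq1 : q < 1) :
    ∃ S : Xr →L[ℝ] Xw,
      (∀ r, S r = S0 (W (S r)) + S0 r) ∧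
      (∀ r (y : Xw), y = S0 (W y) + S0 r → y = S r) ∧
      ‖S‖ ≤ (1 - q)⁻¹ * ‖S0‖ := by
  refine ⟨(Ring.inverse (1 - S0.comp W) : Xw →L[ℝ] Xw).comp S0, ?_, ?_, ?_⟩
  · intro r
    exact (neumann_solve (S0.comp W) hq hq1 (S0 r)).1
  · intro r y hy
    exact (neumann_solve (S0.comp W) hq hq1 (S0 r)).2.1 y hy
  · have hn := (neumann_solve (S0.comp W) hq hq1 0).2.2
    calc ‖(Ring.inverse (1 - S0.comp W) : Xw →L[ℝ] Xw).comp S0‖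
        ≤ ‖(Ring.inverse (1 - S0.comp W) : Xw →L[ℝ] Xw)‖ * ‖S0‖ :=
          ContinuousLinearMap.opNorm_comp_le _ _
      _ ≤ (1 - q)⁻¹ * ‖S0‖ := mul_le_mul_of_nonneg_right hn (norm_nonneg _)

/-- The print's constants: `‖S⁰𝒲‖ ≤ ½` ⇒ `‖S‖ ≤ 2‖S⁰‖` (`≤ 2C`).
[cite: DimockYuan2024GNFlow, proof of Lemma 22 (arXiv:2303.07916v3 TeX ll. 3988–3994)] -/
theorem DimockYuan2024_lemma22_half (S0 : Xr →L[ℝ] Xw) (W : Xw →L[ℝ] Xr) {C : ℝ}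
    (hS0 : ‖S0‖ ≤ C) (hq : ‖S0.comp W‖ ≤ 1 / 2) :
    ∃ S : Xr →L[ℝ] Xw,
      (∀ r, S r = S0 (W (S r)) + S0 r) ∧
      (∀ r (y : Xw), y = S0 (W y) + S0 r → y = S r) ∧ ‖S‖ ≤ 2 * C := by
  obtain ⟨S, h1, h2, h3⟩ := DimockYuan2024_lemma22_mechanism S0 W hq (by norm_num)
  refine ⟨S, h1, h2, h3.trans ?_⟩
  norm_num
  linarith [norm_nonneg S0]

/-- **Dimock–Yuan 2024, Lemma 22 (pixie2) — assembled in the printed shape.**  *"Then for `r ∈ X_r` there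
exists a unique solution of (lumbar) `y_{k+1} = D_xΦ_k(t,x_k)y_k + r_k` in `X_w` with null boundary conditions
(bc0).  There is a constant `C` such that the linear solution operator `y = S(t,x)r` satisfies
`‖S(t,x)‖_{𝓛(X^r,X^w)} ≤ C`"*: with `D : y ↦ (y_{k+1} − L_k y_k)_k` (null boundary conditions built into
`X_w`), its two-sided inverse `S⁰` (Lemma 18) and `𝒲 = D_xΦ_k(t,x_k) − L_k` (Lemma 21) satisfying
`‖S⁰𝒲‖ ≤ q < 1`, there is `S : X_r →L X_w` with `D(Sr) = 𝒲(Sr) + r` for all `r`, every solution of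
`Dy = 𝒲y + r` equals `Sr`, and `‖S‖ ≤ (1 − q)⁻¹‖S⁰‖`.  The single-step content (what `D_xΦ_k(t,x_k)` IS,
and Lemma 21's four block bounds in D10's Banach norms) is not modelled; see Parts 2–3 for its scalar `VV`
block and `norm_S0W_le` for the block assembly.
[cite: DimockYuan2024GNFlow, Lemma 22 (\label{pixie2}) (arXiv:2303.07916v3 TeX ll. 3951–3963, p. 66)] -/
theorem DimockYuan2024_lemma22 (D : Xw →L[ℝ] Xr) (S0 : Xr →L[ℝ] Xw) (hDS : ∀ r, D (S0 r) = r)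
    (hSD : ∀ y, S0 (D y) = y) (W : Xw →L[ℝ] Xr) {q : ℝ} (hq : ‖S0.comp W‖ ≤ q) (hq1 : q < 1) :
    ∃ S : Xr →L[ℝ] Xw,
      (∀ r, D (S r) = W (S r) + r) ∧ (∀ r (y : Xw), D y = W y + r → y = S r) ∧
      ‖S‖ ≤ (1 - q)⁻¹ * ‖S0‖ := by
  obtain ⟨S, h1, h2, h3⟩ := DimockYuan2024_lemma22_mechanism S0 W hq hq1
  refine ⟨S, fun r => ?_, fun r y hy => ?_, h3⟩
  · exact (verynew_iff D S0 hDS hSD W (S r) r).mpr (h1 r)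
  · exact h2 r y ((verynew_iff D S0 hDS hSD W y r).mp hy)

end Mechanism

/-! ### The `2 × 2` block estimate behind *"each entry is small"* (ll. 3996–4020) -/

section Blocks

variable {E V E' V' : Type*} [NormedAddCommGroup E] [NormedSpace ℝ E] [NormedAddCommGroup V]
  [NormedSpace ℝ V] [NormedAddCommGroup E'] [NormedSpace ℝ E'] [NormedAddCommGroup V']
  [NormedSpace ℝ V']

/-- Operator norm of a `2 × 2` block operator on sup-normed products: `‖[[A, B],[C, D]]‖ ≤
max(‖A‖ + ‖B‖, ‖C‖ + ‖D‖)`. [folklore] -/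
theorem opNorm_blocks_le (A : E →L[ℝ] E') (B : V →L[ℝ] E') (C : E →L[ℝ] V') (D : V →L[ℝ] V') :
    ‖(A.coprod B).prod (C.coprod D)‖ ≤ max (‖A‖ + ‖B‖) (‖C‖ + ‖D‖) := by
  refine ContinuousLinearMap.opNorm_le_bound _ (le_max_of_le_left (by positivity)) fun x => ?_
  rcases x with ⟨e, v⟩
  have he : ‖e‖ ≤ ‖(e, v)‖ := norm_fst_le (e, v)
  have hv : ‖v‖ ≤ ‖(e, v)‖ := norm_snd_le (e, v)
  rw [ContinuousLinearMap.prod_apply, Prod.norm_def]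
  simp only [ContinuousLinearMap.coprod_apply]
  refine max_le ?_ ?_
  · calc ‖A e + B v‖ ≤ ‖A e‖ + ‖B v‖ := norm_add_le _ _
      _ ≤ ‖A‖ * ‖e‖ + ‖B‖ * ‖v‖ := add_le_add (A.le_opNorm e) (B.le_opNorm v)
      _ ≤ ‖A‖ * ‖(e, v)‖ + ‖B‖ * ‖(e, v)‖ :=
          add_le_add (mul_le_mul_of_nonneg_left he (norm_nonneg _))
            (mul_le_mul_of_nonneg_left hv (norm_nonneg _))
      _ = (‖A‖ + ‖B‖) * ‖(e, v)‖ := by ring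
      _ ≤ max (‖A‖ + ‖B‖) (‖C‖ + ‖D‖) * ‖(e, v)‖ :=
          mul_le_mul_of_nonneg_right (le_max_left _ _) (norm_nonneg _)
  · calc ‖C e + D v‖ ≤ ‖C e‖ + ‖D v‖ := norm_add_le _ _
      _ ≤ ‖C‖ * ‖e‖ + ‖D‖ * ‖v‖ := add_le_add (C.le_opNorm e) (D.le_opNorm v)
      _ ≤ ‖C‖ * ‖(e, v)‖ + ‖D‖ * ‖(e, v)‖ :=
          add_le_add (mul_le_mul_of_nonneg_left he (norm_nonneg _))
            (mul_le_mul_of_nonneg_left hv (norm_nonneg _))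
      _ = (‖C‖ + ‖D‖) * ‖(e, v)‖ := by ring
      _ ≤ max (‖A‖ + ‖B‖) (‖C‖ + ‖D‖) * ‖(e, v)‖ :=
          mul_le_mul_of_nonneg_right (le_max_right _ _) (norm_nonneg _)

/-- **`S⁰𝒲 = diag(1, S⁰)·[[𝒲_EE, 𝒲_EV],[𝒲_VE, 𝒲_VV]] = [[𝒲_EE, 𝒲_EV],[S⁰𝒲_VE, S⁰𝒲_VV]]`** (l. 3997–4008),
with the `E`-part of `S⁰` a contraction `J` (*"`‖π_E y‖_{X_w} ≤ ‖r‖_{X_r}`"*, ll. 3565–3571), and the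
resulting bound `‖S⁰𝒲‖ ≤ max(‖𝒲_EE‖ + ‖𝒲_EV‖, ‖S⁰_V‖(‖𝒲_VE‖ + ‖𝒲_VV‖))` on the sup-normed products
`X = X^E × X^V`. [cite: DimockYuan2024GNFlow, proof of Lemma 22 (arXiv:2303.07916v3 TeX ll. 3996–4020)] -/
theorem norm_S0W_le (J : E' →L[ℝ] E) (S0V : V' →L[ℝ] V) (hJ : ‖J‖ ≤ 1) (WEE : E →L[ℝ] E')
    (WEV : V →L[ℝ] E') (WVE : E →L[ℝ] V') (WVV : V →L[ℝ] V') :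
    ‖(J.prodMap S0V).comp ((WEE.coprod WEV).prod (WVE.coprod WVV))‖
      ≤ max (‖WEE‖ + ‖WEV‖) (‖S0V‖ * (‖WVE‖ + ‖WVV‖)) := by
  have hblocks : (J.prodMap S0V).comp ((WEE.coprod WEV).prod (WVE.coprod WVV))
      = ((J.comp WEE).coprod (J.comp WEV)).prod ((S0V.comp WVE).coprod (S0V.comp WVV)) := by
    apply ContinuousLinearMap.ext
    rintro ⟨e, v⟩
    simp
  rw [hblocks]
  refine (opNorm_blocks_le _ _ _ _).trans (max_le_max ?_ ?_)
  · have h1 : ‖J.comp WEE‖ ≤ ‖WEE‖ :=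
      (ContinuousLinearMap.opNorm_comp_le _ _).trans (by nlinarith [norm_nonneg WEE, norm_nonneg J])
    have h2 : ‖J.comp WEV‖ ≤ ‖WEV‖ :=
      (ContinuousLinearMap.opNorm_comp_le _ _).trans (by nlinarith [norm_nonneg WEV, norm_nonneg J])
    exact add_le_add h1 h2
  · rw [mul_add]
    exact add_le_add (ContinuousLinearMap.opNorm_comp_le _ _) (ContinuousLinearMap.opNorm_comp_le _ _)

/-- *"We argue that each entry is small"* (ll. 4009–4020) — quantitatively: on the sup-normed product,
four blocks each `≤ ¼` (after the factor `‖S⁰_V‖` on the `V`-row) give `‖S⁰𝒲‖ ≤ ½`, the hypothesis of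
`DimockYuan2024_lemma22_half`.  (Located precision, records only: the print asks each block `< ½`, which on
the sup-normed product yields `‖S⁰𝒲‖ < 1` — invertibility and Lemma 22's `‖S‖ ≤ C` still follow from
`DimockYuan2024_lemma22_mechanism` with `q < 1`, while the displayed `‖(I − S⁰𝒲)⁻¹‖ < 2` wants `≤ ¼` per block,
equally available from Lemma 21 by the same choices of `L, h, g_f`.)
[cite: DimockYuan2024GNFlow, proof of Lemma 22 (arXiv:2303.07916v3 TeX ll. 4009–4020, p. 67)] -/
theorem norm_S0W_le_half (J : E' →L[ℝ] E) (S0V : V' →L[ℝ] V) (hJ : ‖J‖ ≤ 1) (WEE : E →L[ℝ] E')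
    (WEV : V →L[ℝ] E') (WVE : E →L[ℝ] V') (WVV : V →L[ℝ] V') (hEE : ‖WEE‖ ≤ 1 / 4)
    (hEV : ‖WEV‖ ≤ 1 / 4) (hVE : ‖S0V‖ * ‖WVE‖ ≤ 1 / 4) (hVV : ‖S0V‖ * ‖WVV‖ ≤ 1 / 4) :
    ‖(J.prodMap S0V).comp ((WEE.coprod WEV).prod (WVE.coprod WVV))‖ ≤ 1 / 2 := by
  refine (norm_S0W_le J S0V hJ WEE WEV WVE WVV).trans (max_le (by linarith) ?_)
  rw [mul_add]; linarith

end Blocks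

/-! ## Part 6. Theorem 4, last paragraph (ll. 4079–4088): the vacuum energy `ε_k` -/

/-- `ε_{k+1} = L²(ε_k + ε*_k)` solved forward: *"`ε_k = L^{2k}ε_0 + Σ_{j=0}^{k−1} L^{2(k−j)}ε*_j`"*
(`Λ = L²`). [cite: DimockYuan2024GNFlow, proof of Theorem 4 (§4.5), last paragraph (arXiv:2303.07916v3 TeX ll. 4079–4083, p. 68)] -/
theorem vacuumEnergy_closed_form {Λ : ℝ} {ε εstar : ℕ → ℝ}
    (h : ∀ k, ε (k + 1) = Λ * (ε k + εstar k)) (k : ℕ) :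
    ε k = Λ ^ k * ε 0 + ∑ j ∈ range k, Λ ^ (k - j) * εstar j := by
  induction k with
  | zero => simp
  | succ k ih =>
    rw [h k, ih, Finset.sum_range_succ]
    have hs : ∑ j ∈ range k, Λ ^ (k + 1 - j) * εstar j
        = Λ * ∑ j ∈ range k, Λ ^ (k - j) * εstar j := by
      rw [Finset.mul_sum]
      refine Finset.sum_congr rfl fun j hj => ?_
      have hjk : j < k := Finset.mem_range.mp hj
      rw [show k + 1 - j = (k - j) + 1 by omega, pow_succ]
      ring
    rw [hs, show k + 1 - k = 1 by omega, pow_succ, pow_one]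
    ring

/-- *"To get `ε_N = 0` we choose `ε_0 = −Σ_{j=0}^{N−1} L^{−2j}ε*_j`"* (`Λ = L² ≠ 0`).
[cite: DimockYuan2024GNFlow, proof of Theorem 4 (§4.5), last display (arXiv:2303.07916v3 TeX ll. 4084–4088, p. 68)] -/
theorem vacuumEnergy_final_zero {Λ : ℝ} (hΛ : Λ ≠ 0) {ε εstar : ℕ → ℝ} (N : ℕ)
    (h : ∀ k, ε (k + 1) = Λ * (ε k + εstar k))
    (h0 : ε 0 = -∑ j ∈ range N, (Λ ^ j)⁻¹ * εstar j) : ε N = 0 := by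
  rw [vacuumEnergy_closed_form h N, h0, mul_neg, Finset.mul_sum, neg_add_eq_sub, sub_eq_zero]
  refine Finset.sum_congr rfl fun j hj => ?_
  have hjN : j ≤ N := (Finset.mem_range.mp hj).le
  rw [← mul_assoc, ← pow_sub₀ Λ hΛ hjN]

end Literature.MathematicalPhysics.QuantumFieldTheory.DimockYuan2024.SecondLinearEquation

end
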